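import Summits.Ventures.Crystal3D.Theorems.StickyWulffConstantGenericWallFloorTwinFrame
import Summits.Ventures.Crystal3D.Theorems.StickyWulffConstantGenericWallFloorSharedTriangle
import HarnessLib

/-!
# Every twin cap of a non-co-axial bicrystal has a junk capper
# (crux `GenericWallFloor`, line `WallLedgerG`; the `#TC` residual is a defect count — cf-p1 ROUTE §81(3))

HONEST FRAMING. Part of the venture `Summits/Ventures/Crystal3D` (cell `crystal3d-full`), helper
`--supports` the crux `GenericWallFloor` (stmt-Ventures-19480), registered line `WallLedgerG`, open stub
`stub_twoSlabAdhesion`.  Both the landed general rung (19480-p1, `general_twoSlabAdhesion_modulo_twinCaps`)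
and the planner's chain ledger (§81(3), target N-TC) leave the residual `#TC` = twin-capped tops/exits of a
grain.  The planner's remark: «if all three cappers were Λ₂-site balls, Λ₂ − Λ₂ would contain two unit
vectors at 60° … — excluded by G's hypothesis».  Here as theorems:

* `capper_not_mem_own_grain` — the twin image `t − A w + 2⟪A w, n⟫ n` of a positive slot over a lattice
  ball `t` is never a site of the same lattice (menu trick: it meets `−A w` at inner product `−1/3`);
* **`not_all_cappers_on_foreign_grain`** — for a NON-co-axial pair the three cappers cannot all be sites
  of the other lattice: their differences `A₁(wᵢ − w₁)` are two ADJACENT unit vectors common to `A₁·Λ₀`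
  and `A₂·Λ₀`, and `coaxial_of_shared_adjacent_slots` (…SharedTriangle) would make the pair co-axial;
* **`exists_junk_capper`** — packing form: if the three cappers of a twin cap at a grain-1 ball are balls
  of `X`, one of them lies on NEITHER lattice.  So `#TC₁ ≤ Σ_{junk j} #{grain-1 balls capped by j}`:
  the residual is a JUNK-BALL count (each junk capper in turn owns a polar triple in the twin frame,
  `twinFrame_of_twinCap`, so the trichotomy applies to it).

Uses: `exists_three_far_slots` (19480-p1, …SlotFrameIdentity), `inner_eq_half_of_pos_pos` (…TwinFrame),
`sub_mem_image_of_mem_affine` / `coaxial_of_shared_adjacent_slots` (…SharedTriangle).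

WHAT THIS IS NOT: no count of junk balls; not the stub; rung F-C1 not moved.
-/

noncomputable section

namespace Summit.Ventures.Crystal3D.Theorems

open Finset
open Literature.MathematicalPhysics.StatisticalMechanics (fccStacking barlowStacking IsHaggSeq constHagg)
open Literature.Barriers.AtomisticToContinuum (barlowAddSubgroupOfConst)
open scoped InnerProductSpace

/-- Differences of slots are lattice vectors. -/
theorem sub_slots_mem_fcc {w₁ w₂ : EuclideanSpace ℝ (Fin 3)} (hw₁ : w₁ ∈ fccSlots) (hw₂ : w₂ ∈ fccSlots) :
    w₂ - w₁ ∈ fccStacking 1 (Real.sqrt (2 / 3)) := by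
  set G₁ : AddSubgroup (EuclideanSpace ℝ (Fin 3)) :=
    barlowAddSubgroupOfConst 1 (Real.sqrt (2 / 3)) constHagg (fun _ => rfl) with hG₁
  have hG₁mem : ∀ w, w ∈ G₁ ↔ w ∈ fccStacking 1 (Real.sqrt (2 / 3)) := fun w => Iff.rfl
  exact (hG₁mem _).1 (G₁.sub_mem ((hG₁mem _).2 (mem_fcc_of_mem_fccSlots hw₂))
    ((hG₁mem _).2 (mem_fcc_of_mem_fccSlots hw₁)))

/-- **A capper is never a ball of its own grain.**  For a `{111}` normal `n` of the grain `A·Λ₀ + t₁`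
(`⟪A w, n⟫ ∈ {0, ±√(2/3)}`) and a lattice ball `t`, the twin image `t − A w + 2⟪A w, n⟫ n` of a positive
slot `w` is NOT a lattice site (menu trick: `⟪−R_n(A w), −A w⟫ = −1/3`). -/
theorem capper_not_mem_own_grain (A : EuclideanSpace ℝ (Fin 3) ≃ₗᵢ[ℝ] EuclideanSpace ℝ (Fin 3))
    (t₁ : EuclideanSpace ℝ (Fin 3)) {n : EuclideanSpace ℝ (Fin 3)} (hn : ‖n‖ = 1)
    (hmenu : ∀ w ∈ fccSlots, ⟪A w, n⟫_ℝ = 0 ∨ ⟪A w, n⟫_ℝ = Real.sqrt (2 / 3) ∨ ⟪A w, n⟫_ℝ = -Real.sqrt (2 / 3))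
    {t : EuclideanSpace ℝ (Fin 3)} (ht : t ∈ (fun p => A p + t₁) '' fccStacking 1 (Real.sqrt (2 / 3)))
    {w : EuclideanSpace ℝ (Fin 3)} (hw : w ∈ fccSlots) (hpos : 0 < ⟪A w, n⟫_ℝ) :
    t - A w + (2 * ⟪A w, n⟫_ℝ) • n ∉ (fun p => A p + t₁) '' fccStacking 1 (Real.sqrt (2 / 3)) := by
  intro hc
  have h23 : Real.sqrt (2 / 3) ^ 2 = 2 / 3 := Real.sq_sqrt (by norm_num)
  have hval : ⟪A w, n⟫_ℝ = Real.sqrt (2 / 3) := by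
    rcases hmenu w hw with h | h | h
    · rw [h] at hpos; exact absurd hpos (lt_irrefl 0)
    · exact h
    · rw [h] at hpos; linarith [Real.sqrt_nonneg (2 / 3)]
  -- the difference `c − t = −A w + 2⟪A w,n⟫ n` is a unit lattice vector of `A·Λ₀`
  set d : EuclideanSpace ℝ (Fin 3) := -A w + (2 * ⟪A w, n⟫_ℝ) • n with hd
  have hdmem : d ∈ A '' fccStacking 1 (Real.sqrt (2 / 3)) := by
    have := sub_mem_image_of_mem_affine A t₁ _ _ hc ht
    convert this using 1
    rw [hd]; abel
  have hnn : ⟪n, n⟫_ℝ = 1 := by rw [real_inner_self_eq_norm_sq, hn, one_pow]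
  have hww : ⟪A w, A w⟫_ℝ = 1 := by
    rw [real_inner_self_eq_norm_sq, LinearIsometryEquiv.norm_map, norm_eq_one_of_mem_fccSlots hw, one_pow]
  have hdn : ‖d‖ = 1 := by
    have h2 : ‖d‖ ^ 2 = 1 := by
      rw [← real_inner_self_eq_norm_sq, hd, inner_add_left, inner_add_right, inner_add_right, inner_neg_left,
        inner_neg_left, inner_neg_right, inner_neg_right, real_inner_smul_left, real_inner_smul_right,
        real_inner_smul_left, real_inner_smul_right, hww, hnn, real_inner_comm (A w) n, hval]
      nlinarith [h23]
    have := (sq_eq_sq₀ (norm_nonneg _) zero_le_one).1 (by rw [h2, one_pow])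
    exact this
  -- and `−A w` is a unit lattice vector too; their inner product is `−1/3`, not a slot value
  have hneg : -A w ∈ A '' fccStacking 1 (Real.sqrt (2 / 3)) :=
    ⟨-w, mem_fcc_of_mem_fccSlots (neg_mem_fccSlots hw), by rw [map_neg]⟩
  have hin : ⟪d, -A w⟫_ℝ = -(1 / 3) := by
    rw [hd, inner_add_left, inner_neg_left, inner_neg_right, inner_neg_right, real_inner_smul_left, hww,
      real_inner_comm (A w) n, hval]
    nlinarith [h23]
  have hmenu2 := inner_mem_of_unit_slots A hdmem hneg hdn
    (by rw [norm_neg, LinearIsometryEquiv.norm_map, norm_eq_one_of_mem_fccSlots hw])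
  rcases hmenu2 with h | h | h | h | h <;> linarith

/-- **JUNK CAPPER LEMMA.**  In a NON-co-axial pair `(A₁·Λ₀ + t₁, A₂·Λ₀ + t₂)`, the three cappers of an
exact twin cap of grain 1 (normal `n`, twin images `t − A₁ w + 2⟪A₁ w, n⟫ n` of the three positive slots)
cannot ALL lie on grain 2: their pairwise differences would be two adjacent unit vectors common to `A₁·Λ₀`
and `A₂·Λ₀`, forcing co-axiality (`coaxial_of_shared_adjacent_slots`).  With `capper_not_mem_own_grain`:
every twin cap has a capper on NEITHER lattice — the residual `#TC` of the general-filling rung is a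
defect (junk-ball) count (cf-p1 ROUTE §81(3)). -/
theorem not_all_cappers_on_foreign_grain
    (A₁ A₂ : EuclideanSpace ℝ (Fin 3) ≃ₗᵢ[ℝ] EuclideanSpace ℝ (Fin 3)) (t₁ t₂ : EuclideanSpace ℝ (Fin 3))
    (hnc : ¬ ∃ (L' : EuclideanSpace ℝ (Fin 3) ≃ₗᵢ[ℝ] EuclideanSpace ℝ (Fin 3))
      (s₁ s₂ : EuclideanSpace ℝ (Fin 3)) (σ σ' : ℤ → ℤ), IsHaggSeq σ ∧ IsHaggSeq σ' ∧
      (fun p => A₁ p + t₁) '' fccStacking 1 (Real.sqrt (2 / 3)) ⊆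
        (fun p => L' p + s₁) '' barlowStacking 1 (Real.sqrt (2 / 3)) σ ∧
      (fun p => A₂ p + t₂) '' fccStacking 1 (Real.sqrt (2 / 3)) ⊆
        (fun p => L' p + s₂) '' barlowStacking 1 (Real.sqrt (2 / 3)) σ')
    {n : EuclideanSpace ℝ (Fin 3)} (hn : ‖n‖ = 1)
    (hmenu : ∀ w ∈ fccSlots, ⟪A₁ w, n⟫_ℝ = 0 ∨ ⟪A₁ w, n⟫_ℝ = Real.sqrt (2 / 3) ∨ ⟪A₁ w, n⟫_ℝ = -Real.sqrt (2 / 3))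
    (t : EuclideanSpace ℝ (Fin 3))
    (hcap : ∀ w ∈ fccSlots, 0 < ⟪A₁ w, n⟫_ℝ →
      t - A₁ w + (2 * ⟪A₁ w, n⟫_ℝ) • n ∈ (fun p => A₂ p + t₂) '' fccStacking 1 (Real.sqrt (2 / 3))) :
    False := by
  have hpos : 0 < Real.sqrt (2 / 3) := Real.sqrt_pos.2 (by norm_num)
  obtain ⟨w₁, hw₁, w₂, hw₂, w₃, hw₃, h12, h13, h23, e₁, e₂, e₃⟩ := exists_three_far_slots A₁ hn hmenu
  have p₁ : 0 < ⟪A₁ w₁, n⟫_ℝ := by rw [e₁]; exact hpos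
  have p₂ : 0 < ⟪A₁ w₂, n⟫_ℝ := by rw [e₂]; exact hpos
  have p₃ : 0 < ⟪A₁ w₃, n⟫_ℝ := by rw [e₃]; exact hpos
  have c₁ := hcap w₁ hw₁ p₁
  have c₂ := hcap w₂ hw₂ p₂
  have c₃ := hcap w₃ hw₃ p₃
  -- the capper differences are `A₁ (wᵢ − w₁)`
  have hdiff : ∀ {w w' : EuclideanSpace ℝ (Fin 3)}, ⟪A₁ w, n⟫_ℝ = Real.sqrt (2 / 3) →
      ⟪A₁ w', n⟫_ℝ = Real.sqrt (2 / 3) →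
      (t - A₁ w + (2 * ⟪A₁ w, n⟫_ℝ) • n) - (t - A₁ w' + (2 * ⟪A₁ w', n⟫_ℝ) • n) = A₁ (w' - w) := by
    intro w w' e e'
    rw [e, e', map_sub]; abel
  have a_mem₂ : A₁ (w₂ - w₁) ∈ A₂ '' fccStacking 1 (Real.sqrt (2 / 3)) := by
    rw [← hdiff e₁ e₂]; exact sub_mem_image_of_mem_affine A₂ t₂ _ _ c₁ c₂
  have b_mem₂ : A₁ (w₃ - w₁) ∈ A₂ '' fccStacking 1 (Real.sqrt (2 / 3)) := by
    rw [← hdiff e₁ e₃]; exact sub_mem_image_of_mem_affine A₂ t₂ _ _ c₁ c₃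
  have a_mem₁ : A₁ (w₂ - w₁) ∈ A₁ '' fccStacking 1 (Real.sqrt (2 / 3)) := ⟨_, sub_slots_mem_fcc hw₁ hw₂, rfl⟩
  have b_mem₁ : A₁ (w₃ - w₁) ∈ A₁ '' fccStacking 1 (Real.sqrt (2 / 3)) := ⟨_, sub_slots_mem_fcc hw₁ hw₃, rfl⟩
  -- adjacency: the positive slots are pairwise at `60°`
  have i12 := inner_eq_half_of_pos_pos A₁ hn hmenu hw₁ hw₂ h12 p₁ p₂
  have i13 := inner_eq_half_of_pos_pos A₁ hn hmenu hw₁ hw₃ h13 p₁ p₃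
  have i23 := inner_eq_half_of_pos_pos A₁ hn hmenu hw₂ hw₃ h23 p₂ p₃
  have n1 : ⟪w₁, w₁⟫_ℝ = 1 := by rw [real_inner_self_eq_norm_sq, norm_eq_one_of_mem_fccSlots hw₁, one_pow]
  have n2 : ⟪w₂, w₂⟫_ℝ = 1 := by rw [real_inner_self_eq_norm_sq, norm_eq_one_of_mem_fccSlots hw₂, one_pow]
  have n3 : ⟪w₃, w₃⟫_ℝ = 1 := by rw [real_inner_self_eq_norm_sq, norm_eq_one_of_mem_fccSlots hw₃, one_pow]
  have ha : ‖A₁ (w₂ - w₁)‖ = 1 := by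
    rw [LinearIsometryEquiv.norm_map]
    have h2 : ‖w₂ - w₁‖ ^ 2 = 1 ^ 2 := by
      rw [norm_sub_sq_real, norm_eq_one_of_mem_fccSlots hw₁, norm_eq_one_of_mem_fccSlots hw₂,
        real_inner_comm, i12]; norm_num
    exact (sq_eq_sq₀ (norm_nonneg _) zero_le_one).1 h2
  have hb : ‖A₁ (w₃ - w₁)‖ = 1 := by
    rw [LinearIsometryEquiv.norm_map]
    have h2 : ‖w₃ - w₁‖ ^ 2 = 1 ^ 2 := by
      rw [norm_sub_sq_real, norm_eq_one_of_mem_fccSlots hw₁, norm_eq_one_of_mem_fccSlots hw₃,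
        real_inner_comm, i13]; norm_num
    exact (sq_eq_sq₀ (norm_nonneg _) zero_le_one).1 h2
  have hab : ⟪A₁ (w₂ - w₁), A₁ (w₃ - w₁)⟫_ℝ = 1 / 2 := by
    rw [LinearIsometryEquiv.inner_map_map, inner_sub_left, inner_sub_right, inner_sub_right, i23,
      real_inner_comm w₁ w₂, i12, i13, n1]
    norm_num
  exact hnc (coaxial_of_shared_adjacent_slots A₁ A₂ t₁ t₂ _ _ a_mem₁ b_mem₁ a_mem₂ b_mem₂ ha hb hab)

/-- **Every twin cap has a JUNK capper** (a ball on neither lattice).  Packing form: if the twin images of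
the three positive slots of a twin cap at the grain-1 ball `t` all carry balls of `X`, one of them is a
ball of `X` lying on neither `A₁·Λ₀ + t₁` nor `A₂·Λ₀ + t₂`. -/
theorem exists_junk_capper
    (A₁ A₂ : EuclideanSpace ℝ (Fin 3) ≃ₗᵢ[ℝ] EuclideanSpace ℝ (Fin 3)) (t₁ t₂ : EuclideanSpace ℝ (Fin 3))
    (hnc : ¬ ∃ (L' : EuclideanSpace ℝ (Fin 3) ≃ₗᵢ[ℝ] EuclideanSpace ℝ (Fin 3))
      (s₁ s₂ : EuclideanSpace ℝ (Fin 3)) (σ σ' : ℤ → ℤ), IsHaggSeq σ ∧ IsHaggSeq σ' ∧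
      (fun p => A₁ p + t₁) '' fccStacking 1 (Real.sqrt (2 / 3)) ⊆
        (fun p => L' p + s₁) '' barlowStacking 1 (Real.sqrt (2 / 3)) σ ∧
      (fun p => A₂ p + t₂) '' fccStacking 1 (Real.sqrt (2 / 3)) ⊆
        (fun p => L' p + s₂) '' barlowStacking 1 (Real.sqrt (2 / 3)) σ')
    {X : Finset (EuclideanSpace ℝ (Fin 3))}
    {n : EuclideanSpace ℝ (Fin 3)} (hn : ‖n‖ = 1)
    (hmenu : ∀ w ∈ fccSlots, ⟪A₁ w, n⟫_ℝ = 0 ∨ ⟪A₁ w, n⟫_ℝ = Real.sqrt (2 / 3) ∨ ⟪A₁ w, n⟫_ℝ = -Real.sqrt (2 / 3))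
    {t : EuclideanSpace ℝ (Fin 3)} (ht : t ∈ (fun p => A₁ p + t₁) '' fccStacking 1 (Real.sqrt (2 / 3)))
    (hcap : ∀ w ∈ fccSlots, 0 < ⟪A₁ w, n⟫_ℝ → t - A₁ w + (2 * ⟪A₁ w, n⟫_ℝ) • n ∈ X) :
    ∃ w ∈ fccSlots, 0 < ⟪A₁ w, n⟫_ℝ ∧ t - A₁ w + (2 * ⟪A₁ w, n⟫_ℝ) • n ∈ X ∧
      t - A₁ w + (2 * ⟪A₁ w, n⟫_ℝ) • n ∉ (fun p => A₁ p + t₁) '' fccStacking 1 (Real.sqrt (2 / 3)) ∧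
      t - A₁ w + (2 * ⟪A₁ w, n⟫_ℝ) • n ∉ (fun p => A₂ p + t₂) '' fccStacking 1 (Real.sqrt (2 / 3)) := by
  by_contra H
  push Not at H
  refine not_all_cappers_on_foreign_grain A₁ A₂ t₁ t₂ hnc hn hmenu t fun w hw hpos => ?_
  exact H w hw hpos (hcap w hw hpos) (capper_not_mem_own_grain A₁ t₁ hn hmenu ht hw hpos)

end Summit.Ventures.Crystal3D.Theorems

end
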